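import Summits.QuantumFields.YangMills.Theorems.BalabanUVNodesK1R9WindowConjunctIdle
import Summits.QuantumFields.YangMills.Theorems.BalabanUVNodesK1EndOfRunRowsNoShrinkSurvCont
import Summits.QuantumFields.YangMills.Theorems.BalabanUVNodesN17RunRemAtOfShiftAnchorLevel

/-!
# K1⁹'s END-EXACT RESERVE DIAL, RE-PINNED TO ROUTE REV 29, BY NAME: the served `closes` of `route-QuantumFields-BalabanUVNodes` stands on
# «K1⁹ with its rows (i)(iv) replaced by the END-exact letters (W)(T)» — kernel glue over the route decls and this lineage's END files

Cell `pub-ymgap`, seat `pub-ymgap-dag-n13-w4` (g8), N13 [B16] width seat 4∕4; `--kind proof --supports stmt-QuantumFields-27364 --as helper` (K1⁹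
`…Theses.BalabanUVNodes.StabilityBRunRowsAtRecordR13SepCoPHV`, crux r3 DECIDING of route rev 29 commit 5c92291ad69b).  PORT WITH ATTRIBUTION of the YM-NODE-O IDEATION
cell's seat P3 («weaken the target») evidence n°95 `run/shared/lean/pub/ym-nodeO-ideate/memos/lines/Rev29VEndExact-P3g54.lean` (sha256 e2413340c537c1f7…, g54, attached on
stmt-QuantumFields-27364 2026-08-28T10:20Z) **§10 :1239–:1469** (the rev-29 re-pin of the END-exact dial) and §9 :809–:865 (the θ-level rows ladder and the END road at the
datum) — a planner seat files nothing under `Theorems/`; P3's names are quoted decl by decl in the docstrings.  DEF-FREE EDITION: P3's dial predicates `RunRowsWindowTopRuns13` ∕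
`RunRowsWindowNoShrink13` ∕ `K1R9WRTR` ∕ `K2R9WRTR` appear here as INLINE TEXTS (P3's filing-ready spelling `K1R9WRTRItemText` :1449), so that nothing is defined in a proof file.

R-30 HONOURED VERBATIM (P3): the dial is a LOCATED RESERVE — nothing is filed as an item here, no objection to rev 29, no re-key asked; this file is a BY-NAME CERTIFICATE that
the served glue closes rung R4 from K0⁷ + the END-exact K1 text + K3⁸, evidence for the planner of record and nothing more.

THE LETTERS (all about `β_θ := Node00.betaOfRecord₁₃ F 2 θ.toStage13Params`, θ-level, slot-free; (0.20) = `FlowStep.RGEqH`):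
* (W) WINDOW RUNS — runs of every length `K` solving (0.20) inside every window `]0, γ]`, `γ ≤ γ₀`;
* (T) TOP-RUN THRESHOLDS — at every level `γ ≤ γ′` some `g⋆(γ) > 0` below which no in-`]0,γ]` run that VISITS `γ` can end;
* (C) run-wise SURVIVOR CONTINUITY `SurvCont β_θ γ₀` ([Balaban1987RG1] §1 pp. 263–264, asserted in print without proof).
The pressed rows of K1⁹ are (i) run-wise constant remainder, (iv) run-wise partial-sum floor, (C) (`K1R8RowsDefs.RunRowsCont13 F θ`, `Iff.rfl` with the item's inline conjunct).

WHAT THIS FILE PROVES (theorems only; 0 `def`):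
* §1 θ-LEVEL LADDER: pressed rows ⟹ END-minimal rows {(W), no-(1+β₀)⁻¹-shrink, (C)} ⟹ END-exact rows {(W), (T), (C)} (`windowTopRunsRows_of_windowNoShrinkRows`,
  `windowTopRunsRows_of_runRowsCont13`; P3 :818 ∕ :830; edges = this lineage's `windowRowsNoShrink_of_runRowsPS` (p619590) and `topRuns_of_noShrink` (p617600) BY NAME).
* §2 THE END AT THE RECORD ∕ AT EVERY SLOT DATUM FROM THE END-EXACT ROWS (`endpointExistence_datumOfRecord₁₃SepCoPH_of_windowTopRuns`, general `N`; `…SepCoPHV_of_windowTopRuns`;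
  ★ `endpointGivenWindowTopRunsRowsR13SepCoPHV` = P3's display `K2R9WRTR` HOLDS OUTRIGHT at every slot; the generic slot transfer `k2ShapeDisplayV_of_rowsRoadAtRecord` :1283).
* §3 ★★ THE REV-29 GLUE ON THE END-EXACT DIAL: `uv_of_record13Inhabited_windowTopRunsDial_spine` (P3 `closes29_WRTR` :1350) —
  `Record13SepCoPHInhabited → «K1⁹ with rows ↦ (W)(T)(C)» → SpineGivenEndpointR13SepCoPHV → BalabanLadder.UV`, the route file's `closes` proof (Theses :946) verbatim with its K2⁹
  binder supplied by §2; the landed K1⁹ IMPLIES the dial text (`windowTopRunsDial_of_stabilityBRunRowsAtRecordR13SepCoPHV`, :1376), and the dial text alone delivers exactly what the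
  served `closes` reads at the witness — K1⁷'s conclusion at the slot + the END (`stabilityB_window_end_atSlot_of_windowTopRunsDial`).  The served road from the LANDED items
  (`closes h0 h1 endpointGivenRunRowsR13SepCoPHV_holds h3`, K2⁹ CLOSED by DEF-1 p624498) is NOT restated (P3 :1387 ∕ :1393 stay memo-side).
* §4 EXACTNESS AT EVERY SLOT IN THE DIAL'S OWN SHAPE: given (C) on a level and non-crossing of the in-window runs below it, `EndpointExistence (slot datum).C.toB12 ↔ «(W)(T)(C) rows»`
  (`endpointExistence_datumOfRecord₁₃SepCoPHV_iff_windowTopRunsRows`, :1422, through p625860 :241) — so EVERY K2⁹-shape rows display feeding the END delivers the END-exact rows themselves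
  (`windowTopRunsRows_of_k2ShapeDisplayV`, :1431): nothing weaker than {(W), (T), (C)} feeds the rev-29 glue's END, and the pressed rows feed it only through them.

HONEST FRAMING.  [folklore] glue and quantifier bookkeeping over the route decls and this lineage's END files; NOTHING of Bałaban's analysis is asserted; NO item is filed, re-keyed,
registered or closed; K1⁹ and the dial text are OPEN ∃-side statements of NODE O's size; K1⁹ NOT closed (0∕6 stubs); N13 NOT discharged; counts UNMOVED (typed 28∕28 · discharged 5∕27 ·
A 5∕28).  One finite 𝕋⁴ programme at fixed ε, Bałaban AS PRINTED; R4 = the CONDITIONAL finite-𝕋⁴ rung `BalabanLadder.UV` only — the Yang–Mills mass gap (Clay) is NOT proved by any of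
this; nothing continuum ∕ ℝ⁴ ∕ OS.  No `sorry`, no `axiom`, no `def`, no `instance`, no `notation`.
Sources (context only): [I] T. Bałaban, Commun. Math. Phys. 109 (1987) 249 [Balaban1987RG1] Thm 2 p. 259 (first sentence), (0.17)–(0.20) pp. 255–256, Thm 3 + (1.20)–(1.22) p. 264,
§1 pp. 263–264, (5.10) p. 293; [III] Commun. Math. Phys. 119 (1988) 243 [Balaban1988Convergent] (2.6) p. 255, (2.18) p. 257, Cor. 3 (2.50) p. 264; [16] Commun. Math. Phys. 122 (1989)
355 [Balaban1989LargeFieldII] Thm 1 + (0.1) pp. 355–356.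
-/

noncomputable section

open scoped BigOperators Matrix.Norms.L2Operator

namespace Summit.QuantumFields.YangMills.Theorems.BalabanUVNodesK1R9EndExactDialGlue

open Literature.MathematicalPhysics.QuantumFieldTheory.Balaban1983to89
open Literature.MathematicalPhysics.QuantumFieldTheory.Balaban1983to89.FlowStep
open Literature.MathematicalPhysics.QuantumFieldTheory.Balaban1983to89.FlowStepRuns
open Literature.MathematicalPhysics.QuantumFieldTheory.Balaban1983to89.DagBinding
open Literature.MathematicalPhysics.QuantumFieldTheory.Balaban1983to89.T4Continuum (T4Family FiniteEpsData)
open Summit.QuantumFields.YangMills.Theorems.BalabanUVNodesK2NamedJetsRunRemAt (RunConstRemainder SurvCont Survivors)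
open Summit.QuantumFields.YangMills.Theorems.K1V6Defs (Inhabited13 Window)
open Summit.QuantumFields.YangMills.Theorems.BalabanUVNodesK1R8RowsDefs (RunRowsCont13)
open Summit.QuantumFields.YangMills.Theorems.BalabanUVNodesK1EndOfRunRowsNoShrinkSurvCont (topRuns_of_noShrink)
open Summit.QuantumFields.YangMills.Theorems.BalabanUVNodesK1EndOfWindowRunsNoShrinkSurvCont (windowRowsNoShrink_of_runRowsPS)
open Summit.QuantumFields.YangMills.Theorems.BalabanUVNodesK1EndCriterionCeilingFree (endpointExistence_of_windowRuns_topRuns_survCont)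
open Summit.QuantumFields.YangMills.Theorems.BalabanUVNodesK1R9WindowConjunctIdle (endpointExistence_datumOfRecord₁₃SepCoPHV_iff_windowRuns_topRuns)
open Summit.QuantumFields.YangMills.BalabanUVNodes.N17RunRemAtOfShiftAnchorLevel (survCont_anti)
open Summit.QuantumFields.YangMills.Theses.BalabanUVNodes (Record13SepCoPHInhabited StabilityBRunRowsAtRecordR13SepCoPHV SpineGivenEndpointR13SepCoPHV)

/-! ## §1 The θ-level rows ladder: pressed rows ⟹ END-minimal rows ⟹ END-exact rows -/

section Ladder

variable {F : T4Family} {θ : Node00.Stage13HParams F 2}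

/-- **END-MINIMAL ROWS ⟹ END-EXACT ROWS** (P3 n°95 `runRowsWindowTopRuns13_of_runRowsWindowNoShrink13` :818, texts inline): no-(1+β₀)⁻¹-shrink on `]0, γ′]` ([Balaban1988Convergent]
(2.6), last member) IS the family of LINEAR top-run thresholds `g⋆(γ) = γ∕(1+β₀)`, `γ ≤ γ′` (this lineage's `topRuns_of_noShrink`, p617600, BY NAME); (W) and (C) untouched.
[cite: Balaban1988Convergent, (2.6) p.255; Balaban1987RG1, Thm 2 p.259 (first sentence), (0.20) p.256] -/
theorem windowTopRunsRows_of_windowNoShrinkRows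
    (h : ∃ γ₀ γ' β₀ : ℝ, 0 < γ' ∧ γ' ≤ γ₀ ∧ 0 ≤ β₀ ∧
      (∀ γ : ℝ, 0 < γ → γ ≤ γ₀ → ∀ K : ℕ, ∃ gs : ℕ → ℝ, RGEqH K (Node00.betaOfRecord₁₃ F 2 θ.toStage13Params) gs ∧ Step.InInterval γ K gs) ∧
      (∀ (n : ℕ) (gs : ℕ → ℝ), RGEqH n (Node00.betaOfRecord₁₃ F 2 θ.toStage13Params) gs → Step.InInterval γ' n gs →
        ∀ m n', m < n' → n' ≤ n → gs m ≤ (1 + β₀) * gs n') ∧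
      SurvCont (Node00.betaOfRecord₁₃ F 2 θ.toStage13Params) γ₀) :
    ∃ γ₀ γ' : ℝ, 0 < γ' ∧ γ' ≤ γ₀ ∧
      (∀ γ : ℝ, 0 < γ → γ ≤ γ₀ → ∀ K : ℕ, ∃ gs : ℕ → ℝ, RGEqH K (Node00.betaOfRecord₁₃ F 2 θ.toStage13Params) gs ∧ Step.InInterval γ K gs) ∧
      (∀ γ : ℝ, 0 < γ → γ ≤ γ' → ∃ gstar : ℝ, 0 < gstar ∧
        ∀ (n : ℕ) (gs : ℕ → ℝ), RGEqH n (Node00.betaOfRecord₁₃ F 2 θ.toStage13Params) gs → Step.InInterval γ n gs → ∀ k, k ≤ n → gs k = γ → gstar ≤ gs n) ∧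
      SurvCont (Node00.betaOfRecord₁₃ F 2 θ.toStage13Params) γ₀ := by
  obtain ⟨γ₀, γ', β₀, hγ', hγ'le, hβ₀, hwin, hns, hsc⟩ := h
  refine ⟨γ₀, γ', hγ', hγ'le, hwin, fun γ hγ hγle => ?_, hsc⟩
  exact ⟨γ / (1 + β₀), div_pos hγ (by linarith), topRuns_of_noShrink hβ₀ hns γ hγ hγle⟩

/-- **THE PRESSED ROWS OF K1⁹ ⟹ THE END-EXACT ROWS** (P3 n°95 `runRowsWindowTopRuns13_of_runRowsCont13` :830): rows (i)+(iv)+(C) `K1R8RowsDefs.RunRowsCont13 F θ` give the window runs at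
every level `≤ γ₀` (row (i)), no-halving on a shrunk level (row (iv), dag-n24-w1's edge) and (C) unchanged — this lineage's `windowRowsNoShrink_of_runRowsPS` (p619590) BY NAME — then §1's first
edge.  Row (i) is read ONLY as a producer of (W), row (iv) ONLY as a producer of (T). [cite: Balaban1987RG1, Thm 3 p.264, (0.20) p.256, (5.10) p.293; Balaban1988Convergent, (2.6) p.255] -/
theorem windowTopRunsRows_of_runRowsCont13 (h : RunRowsCont13 F θ) :
    ∃ γ₀ γ' : ℝ, 0 < γ' ∧ γ' ≤ γ₀ ∧
      (∀ γ : ℝ, 0 < γ → γ ≤ γ₀ → ∀ K : ℕ, ∃ gs : ℕ → ℝ, RGEqH K (Node00.betaOfRecord₁₃ F 2 θ.toStage13Params) gs ∧ Step.InInterval γ K gs) ∧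
      (∀ γ : ℝ, 0 < γ → γ ≤ γ' → ∃ gstar : ℝ, 0 < gstar ∧
        ∀ (n : ℕ) (gs : ℕ → ℝ), RGEqH n (Node00.betaOfRecord₁₃ F 2 θ.toStage13Params) gs → Step.InInterval γ n gs → ∀ k, k ≤ n → gs k = γ → gstar ≤ gs n) ∧
      SurvCont (Node00.betaOfRecord₁₃ F 2 θ.toStage13Params) γ₀ :=
  windowTopRunsRows_of_windowNoShrinkRows (windowRowsNoShrink_of_runRowsPS h)

end Ladder

/-! ## §2 The END at the record datum and at every slot datum from the END-exact rows; P3's display `K2R9WRTR` holds outright -/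

section EndRoad

variable {F : T4Family} {N : ℕ} [NeZero N]

/-- **THE END-EXACT ROWS GIVE THE END OF RECORD** at every `(θ, h)` (general `N`; P3 n°95 `endpointExistence_datumOfRecord₁₃SepCoPH_of_windowRuns_topRuns_survCont` :850): this lineage's ★★
`endpointExistence_of_windowRuns_topRuns_survCont` (p621368) BY NAME at the datum's `fwd` field — (W) on `]0, γ₀]`, (T) on `]0, γ′]`, (C) at `γ₀`; NO bound on `β_θ`, NO floor, NO order letter.
CONDITIONAL on the displayed letters (NODE O's); nothing of Bałaban asserted. [cite: Balaban1987RG1, Thm 2 p.259 (first sentence), (0.17)–(0.20) pp.255–256, §1 pp.263–264] -/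
theorem endpointExistence_datumOfRecord₁₃SepCoPH_of_windowTopRuns (θ : Node00.Stage13HParams F N) (h : θ.Provisos₁₃SepCoPH F N)
    {γ₀ γ' : ℝ} (hγ' : 0 < γ') (hγ'le : γ' ≤ γ₀)
    (hwin : ∀ γ : ℝ, 0 < γ → γ ≤ γ₀ → ∀ K : ℕ, ∃ gs : ℕ → ℝ, RGEqH K (Node00.betaOfRecord₁₃ F N θ.toStage13Params) gs ∧ Step.InInterval γ K gs)
    (htop : ∀ γ : ℝ, 0 < γ → γ ≤ γ' → ∃ gstar : ℝ, 0 < gstar ∧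
      ∀ (n : ℕ) (gs : ℕ → ℝ), RGEqH n (Node00.betaOfRecord₁₃ F N θ.toStage13Params) gs → Step.InInterval γ n gs → ∀ k, k ≤ n → gs k = γ → gstar ≤ gs n)
    (hsc : SurvCont (Node00.betaOfRecord₁₃ F N θ.toStage13Params) γ₀) :
    EndpointExistence (Node00.datumOfRecord₁₃SepCoPH F N θ h).C.toB12 :=
  endpointExistence_of_windowRuns_topRuns_survCont (Node00.datumOfRecord₁₃SepCoPH F N θ h).fwd (hγ'.trans_le hγ'le) hγ' hγ'le hwin htop hsc

/-- **… AND AT EVERY SLOT DATUM** `datumOfRecord₁₃SepCoPHV F N θ h v` (DEF-1 p620607): END is version-free — the slot construction's `toB12` is the record's (`Node00.endpointExistence_datumOfRecord₁₃SepCoPHV_iff`,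
`Iff.rfl`). [cite: Balaban1987RG1, Thm 2 p.259 (first sentence); Balaban1988Convergent, (2.18) p.257 (bookkeeping)] -/
theorem endpointExistence_datumOfRecord₁₃SepCoPHV_of_windowTopRuns (θ : Node00.Stage13HParams F N) (h : θ.Provisos₁₃SepCoPH F N) (v : Node00.Revision₁₃ F N θ h)
    {γ₀ γ' : ℝ} (hγ' : 0 < γ') (hγ'le : γ' ≤ γ₀)
    (hwin : ∀ γ : ℝ, 0 < γ → γ ≤ γ₀ → ∀ K : ℕ, ∃ gs : ℕ → ℝ, RGEqH K (Node00.betaOfRecord₁₃ F N θ.toStage13Params) gs ∧ Step.InInterval γ K gs)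
    (htop : ∀ γ : ℝ, 0 < γ → γ ≤ γ' → ∃ gstar : ℝ, 0 < gstar ∧
      ∀ (n : ℕ) (gs : ℕ → ℝ), RGEqH n (Node00.betaOfRecord₁₃ F N θ.toStage13Params) gs → Step.InInterval γ n gs → ∀ k, k ≤ n → gs k = γ → gstar ≤ gs n)
    (hsc : SurvCont (Node00.betaOfRecord₁₃ F N θ.toStage13Params) γ₀) :
    EndpointExistence (Node00.datumOfRecord₁₃SepCoPHV F N θ h v).C.toB12 :=
  (Node00.endpointExistence_datumOfRecord₁₃SepCoPHV_iff F N θ h v).2 (endpointExistence_datumOfRecord₁₃SepCoPH_of_windowTopRuns θ h hγ' hγ'le hwin htop hsc)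

/-- **THE SAME FROM THE BUNDLED END-EXACT ROWS TEXT** (`N = 2`, the route's arity; the shape §1 produces and §3 consumes). [cite: Balaban1987RG1, Thm 2 p.259 (first sentence) (bookkeeping)] -/
theorem endpointExistence_datumOfRecord₁₃SepCoPHV_of_windowTopRunsRows {F : T4Family} (θ : Node00.Stage13HParams F 2) (h : θ.Provisos₁₃SepCoPH F 2)
    (v : Node00.Revision₁₃ F 2 θ h)
    (hrows : ∃ γ₀ γ' : ℝ, 0 < γ' ∧ γ' ≤ γ₀ ∧
      (∀ γ : ℝ, 0 < γ → γ ≤ γ₀ → ∀ K : ℕ, ∃ gs : ℕ → ℝ, RGEqH K (Node00.betaOfRecord₁₃ F 2 θ.toStage13Params) gs ∧ Step.InInterval γ K gs) ∧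
      (∀ γ : ℝ, 0 < γ → γ ≤ γ' → ∃ gstar : ℝ, 0 < gstar ∧
        ∀ (n : ℕ) (gs : ℕ → ℝ), RGEqH n (Node00.betaOfRecord₁₃ F 2 θ.toStage13Params) gs → Step.InInterval γ n gs → ∀ k, k ≤ n → gs k = γ → gstar ≤ gs n) ∧
      SurvCont (Node00.betaOfRecord₁₃ F 2 θ.toStage13Params) γ₀) :
    EndpointExistence (Node00.datumOfRecord₁₃SepCoPHV F 2 θ h v).C.toB12 := by
  obtain ⟨γ₀, γ', hγ', hγ'le, hwin, htop, hsc⟩ := hrows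
  exact endpointExistence_datumOfRecord₁₃SepCoPHV_of_windowTopRuns θ h v hγ' hγ'le hwin htop hsc

/-- **GENERIC SLOT TRANSFER FOR K2-SHAPE DISPLAYS** (P3 n°95 `k2SlotShape_of_rowsRoad` :1283): a rows road proved AT THE RECORD (`Rows F θ → EndpointExistence (datumOfRecord₁₃SepCoPH F 2 θ h).C.toB12`)
proves the K2⁹-shape display «unity ∧ slots → admissibility → (B) at the slot → Rows → window at the slot → END at the slot» at EVERY slot `v` — END is version-free (`Iff.rfl` face); unity,
admissibility, (B) and the window are UNREAD. [cite: Balaban1987RG1, Thm 2 p.259 (first sentence); Balaban1988Convergent, (2.18) p.257 (bookkeeping)] -/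
theorem k2ShapeDisplayV_of_rowsRoadAtRecord (Rows : ∀ F : T4Family, Node00.Stage13HParams F 2 → Prop)
    (road : ∀ (F : T4Family) (θ : Node00.Stage13HParams F 2) (h : θ.Provisos₁₃SepCoPH F 2), Rows F θ → EndpointExistence (Node00.datumOfRecord₁₃SepCoPH F 2 θ h).C.toB12) :
    ∀ (F : T4Family) (θ : Node00.Stage13HParams F 2) (h : θ.Provisos₁₃SepCoPH F 2) (v : Node00.Revision₁₃ F 2 θ h), (θ.ZhUnity F 2 ∧ θ.SlotsNondegenerate₁₃ F 2) → θ.Admissible F 2 →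
      B16.EndStatementBPrinted (Node00.datumOfRecord₁₃SepCoPHV F 2 θ h v).C → Rows F θ → Window (Node00.datumOfRecord₁₃SepCoPHV F 2 θ h v) →
      EndpointExistence (Node00.datumOfRecord₁₃SepCoPHV F 2 θ h v).C.toB12 :=
  fun F θ h v _ _ _ hrows _ => (Node00.endpointExistence_datumOfRecord₁₃SepCoPHV_iff F 2 θ h v).2 (road F θ h hrows)

/-- ★ **P3's DISPLAY `K2R9WRTR` HOLDS OUTRIGHT** (n°95 `k2R9WRTR_holds` :1326, text inline): at every admissible unity Stage-13 tuple with provisos AND EVERY SLOT `v`, (B) at the slot datum + the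
END-exact rows {(W), (T), (C)} of `β_θ` + the window ⟹ `EndpointExistence (slot datum).C.toB12` — the K2⁹-SHAPE partner of the END-exact dial; unity ∕ admissibility ∕ (B) ∕ window UNREAD.
The K2 display the rev-29 glue would read if the deciding crux carried the dial's rows; CONDITIONAL on nothing beyond its displayed rows. [cite: Balaban1987RG1, Thm 2 p.259 (first sentence), (0.20) p.256, §1 pp.263–264] -/
theorem endpointGivenWindowTopRunsRowsR13SepCoPHV :
    ∀ (F : T4Family) (θ : Node00.Stage13HParams F 2) (h : θ.Provisos₁₃SepCoPH F 2) (v : Node00.Revision₁₃ F 2 θ h), (θ.ZhUnity F 2 ∧ θ.SlotsNondegenerate₁₃ F 2) → θ.Admissible F 2 →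
      B16.EndStatementBPrinted (Node00.datumOfRecord₁₃SepCoPHV F 2 θ h v).C →
      (∃ γ₀ γ' : ℝ, 0 < γ' ∧ γ' ≤ γ₀ ∧
        (∀ γ : ℝ, 0 < γ → γ ≤ γ₀ → ∀ K : ℕ, ∃ gs : ℕ → ℝ, RGEqH K (Node00.betaOfRecord₁₃ F 2 θ.toStage13Params) gs ∧ Step.InInterval γ K gs) ∧
        (∀ γ : ℝ, 0 < γ → γ ≤ γ' → ∃ gstar : ℝ, 0 < gstar ∧
          ∀ (n : ℕ) (gs : ℕ → ℝ), RGEqH n (Node00.betaOfRecord₁₃ F 2 θ.toStage13Params) gs → Step.InInterval γ n gs → ∀ k, k ≤ n → gs k = γ → gstar ≤ gs n) ∧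
        SurvCont (Node00.betaOfRecord₁₃ F 2 θ.toStage13Params) γ₀) →
      Window (Node00.datumOfRecord₁₃SepCoPHV F 2 θ h v) → EndpointExistence (Node00.datumOfRecord₁₃SepCoPHV F 2 θ h v).C.toB12 :=
  fun _ θ h v _ _ _ hrows _ => endpointExistence_datumOfRecord₁₃SepCoPHV_of_windowTopRunsRows θ h v hrows

end EndRoad

/-! ## §3 ★★ The rev-29 glue on the END-exact dial; the landed K1⁹ implies the dial; doors -/

section Glue

/-- ★★ **THE SERVED REV-29 GLUE STANDS ON THE END-EXACT DIAL** (P3 n°95 `closes29_WRTR` :1350; dial text `K1R9WRTRItemText` :1449 INLINE as `h1`):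
`K0⁷ Record13SepCoPHInhabited → «K1⁹ with rows (i)(iv)(C) ↦ (W)(T)(C)» → K3⁸ SpineGivenEndpointR13SepCoPHV → BalabanLadder.UV` — the route file's deciding `closes` (Theses :946) VERBATIM, its K2⁹
binder supplied by the kernel through §2's END road.  `h1` is WEAKER than the landed K1⁹ (`windowTopRunsDial_of_stabilityBRunRowsAtRecordR13SepCoPHV` below) and OPEN (∃-side, NODE O's size);
CONDITIONAL on its three displayed binders; R4 = the conditional finite-𝕋⁴ rung only; nothing of Bałaban asserted; no item filed ∕ re-keyed (R-30: a located reserve).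
[cite: Balaban1987RG1, Thm 2 p.259 (first sentence), (0.20) p.256; Balaban1989LargeFieldII, Thm 1 + (0.1) pp.355–356; Balaban1988Convergent, (2.18) p.257, Cor. 3 (2.50) p.264 (bookkeeping)] -/
theorem uv_of_record13Inhabited_windowTopRunsDial_spine (h0 : Record13SepCoPHInhabited)
    (h1 : ∀ F : T4Family, Inhabited13 F → ∃ (θ : Node00.Stage13HParams F 2) (h : θ.Provisos₁₃SepCoPH F 2) (v : Node00.Revision₁₃ F 2 θ h),
      (θ.ZhUnity F 2 ∧ θ.SlotsNondegenerate₁₃ F 2) ∧ θ.Admissible F 2 ∧ B16.EndStatementBPrinted (Node00.datumOfRecord₁₃SepCoPHV F 2 θ h v).C ∧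
      Window (Node00.datumOfRecord₁₃SepCoPHV F 2 θ h v) ∧
      ∃ γ₀ γ' : ℝ, 0 < γ' ∧ γ' ≤ γ₀ ∧
        (∀ γ : ℝ, 0 < γ → γ ≤ γ₀ → ∀ K : ℕ, ∃ gs : ℕ → ℝ, RGEqH K (Node00.betaOfRecord₁₃ F 2 θ.toStage13Params) gs ∧ Step.InInterval γ K gs) ∧
        (∀ γ : ℝ, 0 < γ → γ ≤ γ' → ∃ gstar : ℝ, 0 < gstar ∧
          ∀ (n : ℕ) (gs : ℕ → ℝ), RGEqH n (Node00.betaOfRecord₁₃ F 2 θ.toStage13Params) gs → Step.InInterval γ n gs → ∀ k, k ≤ n → gs k = γ → gstar ≤ gs n) ∧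
        SurvCont (Node00.betaOfRecord₁₃ F 2 θ.toStage13Params) γ₀)
    (h3 : SpineGivenEndpointR13SepCoPHV) : Summit.QuantumFields.YangMills.Theses.BalabanLadder.UV := by
  intro F
  obtain ⟨θ, h, v, hU, hθ, hb, hwin, hrows⟩ := h1 F (h0 F)
  have hend : EndpointExistence (Node00.datumOfRecord₁₃SepCoPHV F 2 θ h v).C.toB12 :=
    endpointExistence_datumOfRecord₁₃SepCoPHV_of_windowTopRunsRows θ h v hrows
  exact ⟨Node00.datumOfRecord₁₃SepCoPHV F 2 θ h v, Node00.isDatumOfRecord₀_datumOfRecord₁₃SepCoPHV F 2 θ h v, hb, hend, h3 F θ h v hU hθ hb hend⟩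

/-- **THE LANDED K1⁹ IMPLIES THE END-EXACT DIAL TEXT** (P3 n°95 `k1R9WRTR_of_landed29` :1376, through the ladder K1⁹ ⟹ K1⁹ᴺˢ ⟹ K1⁹ᵂᴿᴺˢ ⟹ K1⁹ᵂᴿᵀᴿ collapsed by §1): the route decl
`…Theses.BalabanUVNodes.StabilityBRunRowsAtRecordR13SepCoPHV` (stmt-QuantumFields-27364) gives, at its own witness `(θ, h, v)`, the dial's body — same unity ∕ admissibility ∕ (B) ∕ window, rows
weakened to {(W), (T), (C)} by `windowTopRunsRows_of_runRowsCont13` (the item's inline rows conjunct IS `RunRowsCont13 F θ`, `K1R8RowsDefs.runRowsCont13_iff_inline`).  CONDITIONAL on K1⁹ (OPEN).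
[cite: Balaban1989LargeFieldII, Thm 1 + (0.1) pp.355–356; Balaban1987RG1, Thm 3 p.264, (0.20) p.256, (5.10) p.293, §1 pp.263–264 (bookkeeping)] -/
theorem windowTopRunsDial_of_stabilityBRunRowsAtRecordR13SepCoPHV (hK : StabilityBRunRowsAtRecordR13SepCoPHV) :
    ∀ F : T4Family, Inhabited13 F → ∃ (θ : Node00.Stage13HParams F 2) (h : θ.Provisos₁₃SepCoPH F 2) (v : Node00.Revision₁₃ F 2 θ h),
      (θ.ZhUnity F 2 ∧ θ.SlotsNondegenerate₁₃ F 2) ∧ θ.Admissible F 2 ∧ B16.EndStatementBPrinted (Node00.datumOfRecord₁₃SepCoPHV F 2 θ h v).C ∧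
      Window (Node00.datumOfRecord₁₃SepCoPHV F 2 θ h v) ∧
      ∃ γ₀ γ' : ℝ, 0 < γ' ∧ γ' ≤ γ₀ ∧
        (∀ γ : ℝ, 0 < γ → γ ≤ γ₀ → ∀ K : ℕ, ∃ gs : ℕ → ℝ, RGEqH K (Node00.betaOfRecord₁₃ F 2 θ.toStage13Params) gs ∧ Step.InInterval γ K gs) ∧
        (∀ γ : ℝ, 0 < γ → γ ≤ γ' → ∃ gstar : ℝ, 0 < gstar ∧
          ∀ (n : ℕ) (gs : ℕ → ℝ), RGEqH n (Node00.betaOfRecord₁₃ F 2 θ.toStage13Params) gs → Step.InInterval γ n gs → ∀ k, k ≤ n → gs k = γ → gstar ≤ gs n) ∧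
        SurvCont (Node00.betaOfRecord₁₃ F 2 θ.toStage13Params) γ₀ := by
  intro F hF
  obtain ⟨θ, h, v, hU, hθ, hb, hwin, hrows⟩ := hK F hF
  have hrows' : RunRowsCont13 F θ := hrows
  exact ⟨θ, h, v, hU, hθ, hb, hwin, windowTopRunsRows_of_runRowsCont13 hrows'⟩

/-- ★ **WHAT THE DIAL DELIVERS TO THE GLUE — EXACTLY WHAT THE SERVED `closes` READS**: from the END-exact dial text alone, at its witness `(θ, h, v)`: unity ∧ slots, admissibility, (B) at the
slot datum, the window at the slot datum AND `EndpointExistence (slot datum).C.toB12` — i.e. K1⁷'s conclusion at the slot plus the END that the route's `closes` (Theses :946) obtains from its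
K2⁹ binder; the K3⁸ binder then reads nothing else.  So between the landed K1⁹ and the glue's actual consumption sits the dial: K1⁹ ⟹ dial (`windowTopRunsDial_of_stabilityBRunRowsAtRecordR13SepCoPHV`)
⟹ this bundle; the served road itself is `…Theses.BalabanUVNodes.closes h0 h1 …K2R9Holds.endpointGivenRunRowsR13SepCoPHV_holds h3` (K2⁹ CLOSED, DEF-1 p624498) and is NOT restated here.
CONDITIONAL on the dial text (OPEN); closes nothing. [cite: Balaban1987RG1, Thm 2 p.259 (first sentence); Balaban1989LargeFieldII, Thm 1 + (0.1) pp.355–356 (bookkeeping)] -/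
theorem stabilityB_window_end_atSlot_of_windowTopRunsDial
    (h1 : ∀ F : T4Family, Inhabited13 F → ∃ (θ : Node00.Stage13HParams F 2) (h : θ.Provisos₁₃SepCoPH F 2) (v : Node00.Revision₁₃ F 2 θ h),
      (θ.ZhUnity F 2 ∧ θ.SlotsNondegenerate₁₃ F 2) ∧ θ.Admissible F 2 ∧ B16.EndStatementBPrinted (Node00.datumOfRecord₁₃SepCoPHV F 2 θ h v).C ∧
      Window (Node00.datumOfRecord₁₃SepCoPHV F 2 θ h v) ∧
      ∃ γ₀ γ' : ℝ, 0 < γ' ∧ γ' ≤ γ₀ ∧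
        (∀ γ : ℝ, 0 < γ → γ ≤ γ₀ → ∀ K : ℕ, ∃ gs : ℕ → ℝ, RGEqH K (Node00.betaOfRecord₁₃ F 2 θ.toStage13Params) gs ∧ Step.InInterval γ K gs) ∧
        (∀ γ : ℝ, 0 < γ → γ ≤ γ' → ∃ gstar : ℝ, 0 < gstar ∧
          ∀ (n : ℕ) (gs : ℕ → ℝ), RGEqH n (Node00.betaOfRecord₁₃ F 2 θ.toStage13Params) gs → Step.InInterval γ n gs → ∀ k, k ≤ n → gs k = γ → gstar ≤ gs n) ∧
        SurvCont (Node00.betaOfRecord₁₃ F 2 θ.toStage13Params) γ₀) :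
    ∀ F : T4Family, Inhabited13 F → ∃ (θ : Node00.Stage13HParams F 2) (h : θ.Provisos₁₃SepCoPH F 2) (v : Node00.Revision₁₃ F 2 θ h),
      (θ.ZhUnity F 2 ∧ θ.SlotsNondegenerate₁₃ F 2) ∧ θ.Admissible F 2 ∧ B16.EndStatementBPrinted (Node00.datumOfRecord₁₃SepCoPHV F 2 θ h v).C ∧
      Window (Node00.datumOfRecord₁₃SepCoPHV F 2 θ h v) ∧ EndpointExistence (Node00.datumOfRecord₁₃SepCoPHV F 2 θ h v).C.toB12 := by
  intro F hF
  obtain ⟨θ, h, v, hU, hθ, hb, hwin, hrows⟩ := h1 F hF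
  exact ⟨θ, h, v, hU, hθ, hb, hwin, endpointExistence_datumOfRecord₁₃SepCoPHV_of_windowTopRunsRows θ h v hrows⟩

end Glue

/-! ## §4 Exactness at every slot in the dial's own shape; every K2⁹-shape rows display feeds the END only through the END-exact rows -/

section Exactness

variable {F : T4Family}

/-- ★★ **END-EXACTNESS AT EVERY SLOT, IN THE DIAL'S SHAPE** (P3 n°95 `endpointExistence_slotDatum_iff_runRowsWindowTopRuns13` :1422 ∘ :939): at every Stage-13 tuple `θ` with provisos `h` and EVERY
revision `v`, GIVEN (C) `SurvCont β_θ γ₀` on a level `γ₀ > 0` and NON-CROSSING of the in-window (0.20)-runs of `β_θ` below `γ₀` (NODE O's letters, not asserted),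
`EndpointExistence (datumOfRecord₁₃SepCoPHV F 2 θ h v).C.toB12 ↔ «∃ γ₀′ γ′, 0 < γ′ ≤ γ₀′ ∧ (W) on ]0,γ₀′] ∧ (T) on ]0,γ′] ∧ (C) at γ₀′»`.  ⟹: this lineage's β-bound-free criterion at the slot
(p625860 :241: `∃ γ₂, ∀ γ ≤ γ₂, (W)(γ) ∧ (T)(γ)`) restricted to `min γ₂ γ₀`, (C) carried down by dag-n17's `survCont_anti` BY NAME; ⟸: §2 (the rows carry their own (C); the given one is unread).
[cite: Balaban1987RG1, Thm 2 p.259 (first sentence), (0.17)–(0.20) pp.255–256, §1 pp.263–264, §5 p.298 (bookkeeping)] -/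
theorem endpointExistence_datumOfRecord₁₃SepCoPHV_iff_windowTopRunsRows (θ : Node00.Stage13HParams F 2) (h : θ.Provisos₁₃SepCoPH F 2) (v : Node00.Revision₁₃ F 2 θ h)
    {γ₀ : ℝ} (hγ₀ : 0 < γ₀) (hsc : SurvCont (Node00.betaOfRecord₁₃ F 2 θ.toStage13Params) γ₀)
    (hord : ∀ γ : ℝ, 0 < γ → γ ≤ γ₀ → ∀ (n : ℕ) (gs gs' : ℕ → ℝ), RGEqH n (Node00.betaOfRecord₁₃ F 2 θ.toStage13Params) gs →
      RGEqH n (Node00.betaOfRecord₁₃ F 2 θ.toStage13Params) gs' → Step.InInterval γ n gs → Step.InInterval γ n gs' → gs 0 < gs' 0 → ∀ k, k ≤ n → gs k < gs' k) :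
    EndpointExistence (Node00.datumOfRecord₁₃SepCoPHV F 2 θ h v).C.toB12 ↔
      ∃ γ₀' γ' : ℝ, 0 < γ' ∧ γ' ≤ γ₀' ∧
        (∀ γ : ℝ, 0 < γ → γ ≤ γ₀' → ∀ K : ℕ, ∃ gs : ℕ → ℝ, RGEqH K (Node00.betaOfRecord₁₃ F 2 θ.toStage13Params) gs ∧ Step.InInterval γ K gs) ∧
        (∀ γ : ℝ, 0 < γ → γ ≤ γ' → ∃ gstar : ℝ, 0 < gstar ∧
          ∀ (n : ℕ) (gs : ℕ → ℝ), RGEqH n (Node00.betaOfRecord₁₃ F 2 θ.toStage13Params) gs → Step.InInterval γ n gs → ∀ k, k ≤ n → gs k = γ → gstar ≤ gs n) ∧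
        SurvCont (Node00.betaOfRecord₁₃ F 2 θ.toStage13Params) γ₀' := by
  constructor
  · intro hE
    obtain ⟨γ₂, hγ₂, H⟩ := (endpointExistence_datumOfRecord₁₃SepCoPHV_iff_windowRuns_topRuns θ h v hγ₀ hsc hord).1 hE
    have hγ₁ : 0 < min γ₂ γ₀ := lt_min hγ₂ hγ₀
    refine ⟨min γ₂ γ₀, min γ₂ γ₀, hγ₁, le_rfl, fun γ hγ hγle K => (H γ hγ (hγle.trans (min_le_left _ _))).1 K,
      fun γ hγ hγle => (H γ hγ (hγle.trans (min_le_left _ _))).2, survCont_anti hγ₁ (min_le_right _ _) hsc⟩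
  · intro hrows
    exact endpointExistence_datumOfRecord₁₃SepCoPHV_of_windowTopRunsRows θ h v hrows

/-- ★★ **EVERY K2⁹-SHAPE ROWS DISPLAY FEEDS THE END ONLY THROUGH THE END-EXACT ROWS** (P3 n°95 `rowsDisplayV_feeds_END_only_through_windowTopRuns` :1431): for ANY rows predicate `Rows F θ` whose
K2⁹-shape display holds («unity ∧ slots → admissibility → (B) at the slot → Rows → window at the slot → END at the slot», every slot), at every tuple and slot where the display's hypotheses and
`Rows F θ` fire AND `β_θ` has (C) on some level with non-crossing in-window runs below it, the END-exact rows {(W), (T), (C)} THEMSELVES hold.  With §2 (sufficiency outright) this is the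
weaken-the-target census of the K1 → K2 → `closes` seam of rev 29 BY NAME: the END-exact bill is sufficient, and necessary modulo {(C), non-crossing}; K1⁹'s pressed rows are one such `Rows`
(K2⁹, stmt-QuantumFields-27365, CLOSED) and feed the glue only through §1.  [folklore] composition; nothing of Bałaban. [cite: Balaban1987RG1, Thm 2 p.259 (first sentence), (0.20) p.256, §5 p.298 (bookkeeping)] -/
theorem windowTopRunsRows_of_k2ShapeDisplayV (Rows : ∀ F : T4Family, Node00.Stage13HParams F 2 → Prop)
    (hK2 : ∀ (F : T4Family) (θ : Node00.Stage13HParams F 2) (h : θ.Provisos₁₃SepCoPH F 2) (v : Node00.Revision₁₃ F 2 θ h), (θ.ZhUnity F 2 ∧ θ.SlotsNondegenerate₁₃ F 2) → θ.Admissible F 2 →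
      B16.EndStatementBPrinted (Node00.datumOfRecord₁₃SepCoPHV F 2 θ h v).C → Rows F θ → Window (Node00.datumOfRecord₁₃SepCoPHV F 2 θ h v) →
      EndpointExistence (Node00.datumOfRecord₁₃SepCoPHV F 2 θ h v).C.toB12)
    (θ : Node00.Stage13HParams F 2) (h : θ.Provisos₁₃SepCoPH F 2) (v : Node00.Revision₁₃ F 2 θ h) (hU : θ.ZhUnity F 2 ∧ θ.SlotsNondegenerate₁₃ F 2) (hθ : θ.Admissible F 2)
    (hB : B16.EndStatementBPrinted (Node00.datumOfRecord₁₃SepCoPHV F 2 θ h v).C) (hrows : Rows F θ) (hwin : Window (Node00.datumOfRecord₁₃SepCoPHV F 2 θ h v))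
    {γ₀ : ℝ} (hγ₀ : 0 < γ₀) (hsc : SurvCont (Node00.betaOfRecord₁₃ F 2 θ.toStage13Params) γ₀)
    (hord : ∀ γ : ℝ, 0 < γ → γ ≤ γ₀ → ∀ (n : ℕ) (gs gs' : ℕ → ℝ), RGEqH n (Node00.betaOfRecord₁₃ F 2 θ.toStage13Params) gs →
      RGEqH n (Node00.betaOfRecord₁₃ F 2 θ.toStage13Params) gs' → Step.InInterval γ n gs → Step.InInterval γ n gs' → gs 0 < gs' 0 → ∀ k, k ≤ n → gs k < gs' k) :
    ∃ γ₀' γ' : ℝ, 0 < γ' ∧ γ' ≤ γ₀' ∧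
      (∀ γ : ℝ, 0 < γ → γ ≤ γ₀' → ∀ K : ℕ, ∃ gs : ℕ → ℝ, RGEqH K (Node00.betaOfRecord₁₃ F 2 θ.toStage13Params) gs ∧ Step.InInterval γ K gs) ∧
      (∀ γ : ℝ, 0 < γ → γ ≤ γ' → ∃ gstar : ℝ, 0 < gstar ∧
        ∀ (n : ℕ) (gs : ℕ → ℝ), RGEqH n (Node00.betaOfRecord₁₃ F 2 θ.toStage13Params) gs → Step.InInterval γ n gs → ∀ k, k ≤ n → gs k = γ → gstar ≤ gs n) ∧
      SurvCont (Node00.betaOfRecord₁₃ F 2 θ.toStage13Params) γ₀' :=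
  (endpointExistence_datumOfRecord₁₃SepCoPHV_iff_windowTopRunsRows θ h v hγ₀ hsc hord).1 (hK2 F θ h v hU hθ hB hrows hwin)

/-- **IN PARTICULAR FOR THE PRESSED ROWS** (the pair, P3 n°95 `pressedRows_and_endExactRows` :975 at the slot): K1⁹'s rows `RunRowsCont13 F θ` ARE END-exact rows wherever they fire (§1, no side
letter), and conversely at a slot datum whose `β_θ` has (C) + non-crossing the END forces the END-exact rows — NOT rows (i)(iv) (this lineage's FILES 2∕3, p626836 ∕ p628067: first-kick and
fading-kick witnesses carry the END without row (iv)).  Stated as the pair. [cite: Balaban1987RG1, Thm 2 p.259 (first sentence), Thm 3 p.264, (5.10) p.293 (bookkeeping)] -/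
theorem pressedRows_and_endExactRows_at_slot (θ : Node00.Stage13HParams F 2) (h : θ.Provisos₁₃SepCoPH F 2) (v : Node00.Revision₁₃ F 2 θ h) :
    (RunRowsCont13 F θ →
      ∃ γ₀ γ' : ℝ, 0 < γ' ∧ γ' ≤ γ₀ ∧
        (∀ γ : ℝ, 0 < γ → γ ≤ γ₀ → ∀ K : ℕ, ∃ gs : ℕ → ℝ, RGEqH K (Node00.betaOfRecord₁₃ F 2 θ.toStage13Params) gs ∧ Step.InInterval γ K gs) ∧
        (∀ γ : ℝ, 0 < γ → γ ≤ γ' → ∃ gstar : ℝ, 0 < gstar ∧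
          ∀ (n : ℕ) (gs : ℕ → ℝ), RGEqH n (Node00.betaOfRecord₁₃ F 2 θ.toStage13Params) gs → Step.InInterval γ n gs → ∀ k, k ≤ n → gs k = γ → gstar ≤ gs n) ∧
        SurvCont (Node00.betaOfRecord₁₃ F 2 θ.toStage13Params) γ₀) ∧
    (∀ {γ₀ : ℝ}, 0 < γ₀ → SurvCont (Node00.betaOfRecord₁₃ F 2 θ.toStage13Params) γ₀ →
      (∀ γ : ℝ, 0 < γ → γ ≤ γ₀ → ∀ (n : ℕ) (gs gs' : ℕ → ℝ), RGEqH n (Node00.betaOfRecord₁₃ F 2 θ.toStage13Params) gs →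
        RGEqH n (Node00.betaOfRecord₁₃ F 2 θ.toStage13Params) gs' → Step.InInterval γ n gs → Step.InInterval γ n gs' → gs 0 < gs' 0 → ∀ k, k ≤ n → gs k < gs' k) →
      EndpointExistence (Node00.datumOfRecord₁₃SepCoPHV F 2 θ h v).C.toB12 →
      ∃ γ₀' γ' : ℝ, 0 < γ' ∧ γ' ≤ γ₀' ∧
        (∀ γ : ℝ, 0 < γ → γ ≤ γ₀' → ∀ K : ℕ, ∃ gs : ℕ → ℝ, RGEqH K (Node00.betaOfRecord₁₃ F 2 θ.toStage13Params) gs ∧ Step.InInterval γ K gs) ∧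
        (∀ γ : ℝ, 0 < γ → γ ≤ γ' → ∃ gstar : ℝ, 0 < gstar ∧
          ∀ (n : ℕ) (gs : ℕ → ℝ), RGEqH n (Node00.betaOfRecord₁₃ F 2 θ.toStage13Params) gs → Step.InInterval γ n gs → ∀ k, k ≤ n → gs k = γ → gstar ≤ gs n) ∧
        SurvCont (Node00.betaOfRecord₁₃ F 2 θ.toStage13Params) γ₀') :=
  ⟨windowTopRunsRows_of_runRowsCont13, fun hγ₀ hsc hord hE => (endpointExistence_datumOfRecord₁₃SepCoPHV_iff_windowTopRunsRows θ h v hγ₀ hsc hord).1 hE⟩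

end Exactness

end Summit.QuantumFields.YangMills.Theorems.BalabanUVNodesK1R9EndExactDialGlue

end
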